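import Literature.NumberTheory.NumberFields.DyadicNonNormAtPrimeIdeal
import Literature.NumberTheory.NumberFields.UnitNormIndexOneOfRankOne
import HarnessLib

/-!
# A GENUS-CHARACTER CERTIFICATE for `4 ∤ h(K(√2))`: over a base `K` with odd class number, a dyadic prime `𝔭₁` with
# `e = f = 1`, all units `≡ ±1 (mod 𝔭₁³)`, `rank₂ Cl(K(√2)) ≤ 1`, and an ideal `𝔔` of `K(√2)` with `𝔔² = (π)`,
# `π ≡ ±3 (mod 𝔭₁³)` ⟹ `𝔔` is NOT principal and `4 ∤ h(K(√2))` — i.e. `ord₂ h(K(√2)) = 1`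

Topic `NumberTheory/NumberFields` (namespace = path).  THEOREM-ONLY file (no definition, no named fact, no instance, no `sorry`),
written by the prover seat `bsd-line-att-p3` g43 (cell `bsd-f1-sign2`, route `AlignedTransportAtTwo`; `--supports`
stmt-BirchSwinnertonDyer-22298, closes nothing).  It serves the hypothesis `ord₂ h(K_1) ≤ 1` (`classNumberPExp κ 1 ≤ 1`, `K_1 = K(√2)` the
first layer of the cyclotomic `ℤ₂`-extension of an odd-degree `K`) of the depth door (`IwasawaTheory/ClassGroupPRankLeOneOfAmbiguousLayerTwo`,
att-p3 g42) — the one datum of that door about a SEXTIC field —, replacing it by congruences in the base field `K`.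

## The statement (`not_isPrincipal_and_not_four_dvd_of_genusCert`)

`K ⊆ L` number fields, `L/K` Galois of degree `2`, `s ∈ L` with `s² = 2`, `s ∉ K` (so `L = K(√2)`); `h_K` odd; `𝔭₁` a non-zero prime of `𝓞_K`
with residue field `𝔽₂` and `2 ∉ 𝔭₁²` (`e(𝔭₁|2) = f(𝔭₁|2) = 1`); every unit `u` of `K` satisfies `u ≡ ±1 (mod 𝔭₁³)`; `#(Cl_L/Cl_L²) ≤ 2`
(`rank₂ Cl(L) ≤ 1`); `π ∈ 𝓞_K` with `π ≡ ±3 (mod 𝔭₁³)` and an ideal `𝔔` of `𝓞_L` with `𝔔² = π𝓞_L`.  THEN `𝔔` is not principal and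
`4 ∤ h_L` (so, `Cl(L)[2^∞]` being cyclic, `ord₂ h_L = 1`: `padicValNat_two_card_classGroup_eq_one_of_genusCert`).

## Proof (genus theory, the ELEMENTARY direction only)

The map `χ : x ↦ (x, 2)_{𝔭₁}` («`+1` iff `x ≡ ±1 (mod 𝔭₁³)`») is a genus character of `L/K`: by the tree's dyadic lemma
(`DyadicNonNormAtPrimeIdeal.forall_sq_sub_two_mul_sq_ne_of_{sub,add}_three_mem_pow_three`, O'Meara 63:10 / Serre III.1.2 — the direction
«`ε ≡ ±3 (mod 𝔭₁³)` is not `x² − 2y²`») no element `≡ ±3 (mod 𝔭₁³)` of `K` is a norm from `L`.  KEY LEMMA (`intNorm_ne_unit_mul_sq_mul_pow`):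
for `δ ∈ 𝓞_L`, `b ∈ 𝓞_K ∖ 0`, a unit `w` and `n` odd, `N_{L/K}(δ) ≠ w·b²·πⁿ` — write `δ = a + c s` (`a, c ∈ K`), `N(δ) = a² − 2c²`, divide by `b²`:
`(a/b)² − 2(c/b)² = wπⁿ ≡ ±3 (mod 𝔭₁³)`, impossible.  (i) If `𝔔 = (δ)` then `N_{L/K}` of ideals (Mathlib `Ideal.relNorm`: `N(𝔔)² = N(π𝓞_L) = (π)²`,
so `N(𝔔) = (π)`) gives `(π) = (N δ)`, `N δ = wπ`: contradiction — `𝔔` is not principal, `[𝔔]` has order `2`.  (ii) `#Cl_L[2] = #(Cl_L/Cl_L²) ≤ 2`,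
so `[𝔔]` is THE element of order `2`; if `4 ∣ h_L` there is a class `c` with `c² = [𝔔]` (Cauchy in `Cl_L/⟨[𝔔]⟩`), i.e. an integral `𝔅` with
`𝔅²𝔔 = (δ)`; then `N(𝔅)²·(π) = (Nδ)`, and with `h = h_K` odd, `N(𝔅)^h = (b)`: `(b²π^h) = (N(δ^h))`, `N(δ^h) = w b² π^h` — contradiction.
No principal genus theorem, no Hasse norm theorem, no completion is used.

* §1 finite abelian groups: `#ker(x ↦ x²) = #(G/G²)`; with `#(G/G²) ≤ 2` two elements of order `2` coincide, and `4 ∣ #G` makes the element of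
  order `2` a square.
* §2 `L = K ⊕ Ks`: coordinates, the non-trivial automorphism (`σ s = −s`), `N(a + cs) = a² − 2c²`.
* §3 congruences mod `𝔭₁³`: `(±1)·(±3)^{odd} ≡ ±3`; `u² ≡ 1` for `u ∉ 𝔭₁`; ★ `forall_units_sub_one_mem_or_add_one_mem_of_rank_eq_one` — for `K` of odd
  degree and unit rank `1`, ALL units are `≡ ±1 (mod 𝔭₁³)` as soon as ONE unit `ε ≡ ±1` with `±ε` non-squares is displayed (att-p3 g42's
  `AmbiguousClass.eq_top_of_rank_eq_one`).
* §4 ideals: `I² = J² ⟹ I = J` in a Dedekind domain; `N_{L/K}(𝔔) = (π)`.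
* §5 ★★ the certificate theorem and ★★ `padicValNat_two_card_classGroup_eq_one_of_genusCert` (`ord₂ h_L = 1`).

HONEST SCOPE: classical genus theory for a quadratic extension (Gras IV.4; Hasse; Rédei–Reichardt's `4`-rank via genus characters) in its
elementary half; nothing specific to any summit; BSD is not advanced by this file.  USE (cell bsd-f1-sign2, crux C2, sub-cell `Δ_min ≡ 5 (mod 8)`,
`h(ℚ(β)) = 1`, `2 = 𝔭₁𝔭₂`, `f(𝔭₁) = 1`): `π = π₂` a generator of `𝔭₂` (ramified in `K(√2)`: `𝔭₂𝓞_L = 𝔓₂²`), certificate `π₂ ≡ ±3 (mod 𝔭₁³)` — the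
kernel form of the census predictor «`σ₁(π₁)/2 ≡ ±3 (mod 8)`» of att-p3 g41 —, units: `−1` and the census unit `ε` with `σ₁(ε) ≡ ±1 (mod 8)`.

References: [Gras2003] IV.4 (genus theory of `L/K` cyclic: number of ambiguous classes, genus characters); [Serre1973CourseArithmetic] Ch. III
§1.2 Thm. 1 (`(2, u) = (−1)^{ω(u)}` over `ℚ₂`); [Omeara1963] §63B (63:10) (norms from `K(√θ)`); [NeukirchANT1999] Ch. III §1 (1.6) (relative ideal
norm, `N(𝔞𝓞_L) = 𝔞^{[L:K]}`, `N((x)) = (N x)`), Ch. I §7 (Dirichlet); [Lang1990] Ch. 13 §4 Lemma 4.1 (unit index in Chevalley's formula).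
-/

set_option autoImplicit false

noncomputable section

open NumberField NumberField.Units Module
open scoped nonZeroDivisors

namespace Literature.NumberTheory.NumberFields

open Literature.NumberTheory.NumberFields.AmbiguousClass

/-! ## §1 Finite abelian groups with `#(G/G²) ≤ 2` -/

section Group

variable {G : Type*} [CommGroup G] [Finite G]

/-- **`#ker(x ↦ xⁿ) = #(G/Gⁿ)`** for a finite abelian group (`G/ker ≅ Gⁿ`, so `#G = #ker·#Gⁿ = #(G/Gⁿ)·#Gⁿ`). [folklore] -/
private theorem natCard_ker_powMonoidHom_eq_natCard_quotient_range (n : ℕ) :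
    Nat.card (powMonoidHom n : G →* G).ker = Nat.card (G ⧸ (powMonoidHom n : G →* G).range) := by
  have h1 := Subgroup.card_eq_card_quotient_mul_card_subgroup (powMonoidHom n : G →* G).ker
  have h2 := Subgroup.card_eq_card_quotient_mul_card_subgroup (powMonoidHom n : G →* G).range
  have h3 : Nat.card (G ⧸ (powMonoidHom n : G →* G).ker) = Nat.card (powMonoidHom n : G →* G).range :=
    Nat.card_congr (QuotientGroup.quotientKerEquivRange (powMonoidHom n : G →* G)).toEquiv
  rw [h3] at h1
  have hpos : 0 < Nat.card (powMonoidHom n : G →* G).range := Nat.card_pos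
  have h4 : Nat.card (powMonoidHom n : G →* G).range * Nat.card (powMonoidHom n : G →* G).ker =
      Nat.card (powMonoidHom n : G →* G).range * Nat.card (G ⧸ (powMonoidHom n : G →* G).range) := by
    rw [← h1, h2, mul_comm]
  exact Nat.eq_of_mul_eq_mul_left hpos h4

/-- **Two elements of order `2` coincide when `#(G/G²) ≤ 2`** (`G[2] = ker(x ↦ x²)` has at most two elements, one of them `1`). [folklore] -/
private theorem eq_of_sq_eq_one_of_natCard_quotient_le_two
    (hG : Nat.card (G ⧸ (powMonoidHom 2 : G →* G).range) ≤ 2) {x y : G} (hx : x ^ 2 = 1) (hy : y ^ 2 = 1)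
    (hx1 : x ≠ 1) (hy1 : y ≠ 1) : x = y := by
  by_contra hxy
  rw [← natCard_ker_powMonoidHom_eq_natCard_quotient_range 2] at hG
  have hxk : x ∈ (powMonoidHom 2 : G →* G).ker := by rw [MonoidHom.mem_ker, powMonoidHom_apply, hx]
  have hyk : y ∈ (powMonoidHom 2 : G →* G).ker := by rw [MonoidHom.mem_ker, powMonoidHom_apply, hy]
  have h1k : (1 : G) ∈ (powMonoidHom 2 : G →* G).ker := Subgroup.one_mem _
  have hinj : Function.Injective
      (![(⟨1, h1k⟩ : (powMonoidHom 2 : G →* G).ker), ⟨x, hxk⟩, ⟨y, hyk⟩] : Fin 3 → (powMonoidHom 2 : G →* G).ker) := by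
    intro i j hij
    fin_cases i <;> fin_cases j <;> simp_all [eq_comm]
  have h3 := Nat.card_le_card_of_injective _ hinj
  simp only [Nat.card_eq_fintype_card, Fintype.card_fin] at h3
  omega

/-- **When `#(G/G²) ≤ 2` and `4 ∣ #G`, the element of order `2` is a square.**  (Cauchy in `G/⟨q⟩`, of even order: an element `ȳ` of order `2`
lifts to `y ∉ ⟨q⟩` with `y² ∈ ⟨q⟩ = {1, q}`; `y² = 1` would make `y` a second element of order `2`.) [folklore] -/
private theorem exists_sq_eq_of_four_dvd_natCard
    (hG : Nat.card (G ⧸ (powMonoidHom 2 : G →* G).range) ≤ 2) (h4 : 4 ∣ Nat.card G) {q : G} (hq : q ^ 2 = 1)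
    (hq1 : q ≠ 1) : ∃ c : G, c ^ 2 = q := by
  classical
  haveI : Fact (Nat.Prime 2) := ⟨Nat.prime_two⟩
  have horder : orderOf q = 2 := orderOf_eq_prime hq hq1
  have hH : Nat.card (Subgroup.zpowers q) = 2 := by rw [Nat.card_zpowers, horder]
  have hcard := Subgroup.card_eq_card_quotient_mul_card_subgroup (Subgroup.zpowers q)
  rw [hH] at hcard
  have h2 : 2 ∣ Nat.card (G ⧸ Subgroup.zpowers q) := by
    obtain ⟨k, hk⟩ := h4
    exact ⟨k, by omega⟩
  obtain ⟨ybar, hybar⟩ := exists_prime_orderOf_dvd_card' 2 h2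
  obtain ⟨y, rfl⟩ := QuotientGroup.mk_surjective ybar
  -- `y ∉ ⟨q⟩`, `y² ∈ ⟨q⟩`
  have hy1 : y ∉ Subgroup.zpowers q := by
    intro hy
    have : (QuotientGroup.mk y : G ⧸ Subgroup.zpowers q) = 1 := (QuotientGroup.eq_one_iff y).mpr hy
    rw [this, orderOf_one] at hybar
    exact absurd hybar (by norm_num)
  have hy2 : y ^ 2 ∈ Subgroup.zpowers q := by
    rw [← QuotientGroup.eq_one_iff, QuotientGroup.mk_pow, ← hybar]
    exact pow_orderOf_eq_one _
  by_cases hy2one : y ^ 2 = 1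
  · -- then `y` is an element of order `2` different from `q`: impossible
    exfalso
    have hyne : y ≠ 1 := fun h => hy1 (h ▸ Subgroup.one_mem _)
    have hyq : y = q := eq_of_sq_eq_one_of_natCard_quotient_le_two hG hy2one hq hyne hq1
    exact hy1 (hyq ▸ Subgroup.mem_zpowers q)
  · -- `y² ∈ G[2] ∖ {1}`, so `y² = q`
    refine ⟨y, eq_of_sq_eq_one_of_natCard_quotient_le_two hG ?_ hq hy2one hq1⟩
    obtain ⟨k, hk⟩ := Subgroup.mem_zpowers_iff.mp hy2
    rw [← hk, ← zpow_natCast, ← zpow_mul, mul_comm, zpow_mul, zpow_natCast, hq, one_zpow]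

omit [Finite G] in
/-- An element `q ≠ 1` with `q² = 1` of a finite group makes `#G` even. [folklore] -/
private theorem two_dvd_natCard_of_sq_eq_one {q : G} (hq : q ^ 2 = 1) (hq1 : q ≠ 1) : 2 ∣ Nat.card G := by
  haveI : Fact (Nat.Prime 2) := ⟨Nat.prime_two⟩
  have horder : orderOf q = 2 := orderOf_eq_prime hq hq1
  rw [← horder]
  exact orderOf_dvd_natCard q

end Group

/-! ## §2 The quadratic extension `L = K(s)`, `s² = 2`: coordinates, the automorphism `s ↦ −s`, the norm form `a² − 2c²` -/

section Quadratic

variable {K L : Type*} [Field K] [Field L] [Algebra K L]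

/-- **`L = K ⊕ K s`**: `[L : K] = 2` and `s ∉ K` ⟹ every `x ∈ L` is `a + c s` with `a, c ∈ K` (`1, s` are linearly independent, hence a basis).
[cite: NeukirchANT1999, Ch. I §2 (a `K`-basis of a field extension)] -/
theorem exists_eq_add_mul_of_finrank_eq_two (h2 : Module.finrank K L = 2) {s : L} (hsK : ∀ k : K, algebraMap K L k ≠ s)
    (x : L) : ∃ a c : K, x = algebraMap K L a + algebraMap K L c * s := by
  have hli : LinearIndependent K ![(1 : L), s] := by
    rw [LinearIndependent.pair_iff]
    intro a c hac
    by_cases hc : c = 0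
    · rw [hc, zero_smul, add_zero, smul_eq_zero] at hac
      exact ⟨hac.resolve_right one_ne_zero, hc⟩
    · exfalso
      apply hsK (-a / c)
      rw [Algebra.smul_def, Algebra.smul_def, mul_one] at hac
      have hcL : algebraMap K L c ≠ 0 := by
        rw [Ne, map_eq_zero_iff _ (algebraMap K L).injective]; exact hc
      rw [map_div₀, map_neg, div_eq_iff hcL]
      linear_combination -hac
  haveI : Nonempty (Fin 2) := ⟨0⟩
  have hspan := hli.span_eq_top_of_card_eq_finrank (by rw [Fintype.card_fin, h2])
  have hx : x ∈ Submodule.span K (Set.range ![(1 : L), s]) := by rw [hspan]; exact Submodule.mem_top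
  obtain ⟨f, hf⟩ := (Submodule.mem_span_range_iff_exists_fun K).mp hx
  refine ⟨f 0, f 1, ?_⟩
  rw [← hf, Fin.sum_univ_two]
  simp [Algebra.smul_def]

/-- **The non-trivial automorphism negates `s`** (`L/K` Galois of degree `2`, `s² = 2`, `s ∉ K`): there is `σ ∈ Gal(L/K)`, `σ ≠ 1`, and
`σ s = −s` (`(σ s)² = 2` forces `σ s = ±s`; `σ s = s` would fix `K ⊕ Ks = L`). [cite: NeukirchANT1999, Ch. IV §1 (the Galois group of a quadratic extension)] -/
theorem exists_algEquiv_ne_one_apply_eq_neg [FiniteDimensional K L] [IsGalois K L] (h2 : Module.finrank K L = 2) {s : L}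
    (hs : s ^ 2 = 2) (hsK : ∀ k : K, algebraMap K L k ≠ s) :
    ∃ σ : L ≃ₐ[K] L, σ ≠ 1 ∧ σ s = -s := by
  have hcard : Fintype.card (L ≃ₐ[K] L) = 2 := by rw [← Nat.card_eq_fintype_card, IsGalois.card_aut_eq_finrank, h2]
  obtain ⟨σ, hσ⟩ := Fintype.exists_ne_of_one_lt_card (by rw [hcard]; norm_num) (1 : L ≃ₐ[K] L)
  refine ⟨σ, hσ, ?_⟩
  have hσs : (σ s - s) * (σ s + s) = 0 := by
    have h1 : σ s ^ 2 = 2 := by rw [← map_pow, hs, map_ofNat]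
    linear_combination h1 - hs
  rcases mul_eq_zero.mp hσs with h | h
  · -- `σ s = s`: then `σ = 1`
    exfalso
    apply hσ
    ext x
    obtain ⟨a, c, rfl⟩ := exists_eq_add_mul_of_finrank_eq_two h2 hsK x
    rw [map_add, map_mul, AlgEquiv.commutes, AlgEquiv.commutes, sub_eq_zero.mp h, AlgEquiv.one_apply]
  · linear_combination h

/-- **The norm form: `N_{L/K}(a + c s) = a² − 2c²`** (`L/K` Galois quadratic, `s² = 2 ∉ K²`; `N(x) = x·σ(x)` over `Gal(L/K) = {1, σ}`).
[cite: NeukirchANT1999, Ch. I §2 Prop. (2.6) (norm as the product of the conjugates)] [cite: Omeara1963, §63B (63:10) (norms from `K(√θ)` are the `x² − θy²`)] -/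
theorem Algebra.norm_add_mul_eq_sq_sub_two_mul_sq [FiniteDimensional K L] [IsGalois K L] (h2 : Module.finrank K L = 2) {s : L}
    (hs : s ^ 2 = 2) (hsK : ∀ k : K, algebraMap K L k ≠ s) (a c : K) :
    Algebra.norm K (algebraMap K L a + algebraMap K L c * s) = a ^ 2 - 2 * c ^ 2 := by
  classical
  obtain ⟨σ, hσ1, hσs⟩ := exists_algEquiv_ne_one_apply_eq_neg h2 hs hsK
  have hcard : Fintype.card (L ≃ₐ[K] L) = 2 := by rw [← Nat.card_eq_fintype_card, IsGalois.card_aut_eq_finrank, h2]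
  have huniv : ({1, σ} : Finset (L ≃ₐ[K] L)) = Finset.univ :=
    Finset.eq_univ_of_card _ (by rw [Finset.card_pair hσ1.symm, hcard])
  apply (algebraMap K L).injective
  rw [Algebra.norm_eq_prod_automorphisms, ← huniv, Finset.prod_pair hσ1.symm, AlgEquiv.one_apply, map_add, map_mul,
    AlgEquiv.commutes, AlgEquiv.commutes, hσs, map_sub, map_mul, map_pow, map_pow, map_ofNat]
  linear_combination (-(algebraMap K L c) ^ 2) * hs

end Quadratic

/-! ## §3 Congruences modulo `𝔭₁³` at a dyadic prime with `e = f = 1` -/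

section Congruences

variable {R : Type*} [CommRing R] (P : Ideal R)

/-- `u ≡ ±1`, `π ≡ ±3 (mod 𝔭³)` ⟹ `uπ ≡ ±3 (mod 𝔭³)`. [folklore] -/
private theorem mul_sub_three_mem_or_add_three_mem {u π : R} (hu : u - 1 ∈ P ^ 3 ∨ u + 1 ∈ P ^ 3)
    (hπ : π - 3 ∈ P ^ 3 ∨ π + 3 ∈ P ^ 3) : u * π - 3 ∈ P ^ 3 ∨ u * π + 3 ∈ P ^ 3 := by
  rcases hu with hu | hu <;> rcases hπ with hπ | hπ
  · left
    have : u * π - 3 = (u - 1) * π + (π - 3) := by ring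
    rw [this]; exact Ideal.add_mem _ (Ideal.mul_mem_right _ _ hu) hπ
  · right
    have : u * π + 3 = (u - 1) * π + (π + 3) := by ring
    rw [this]; exact Ideal.add_mem _ (Ideal.mul_mem_right _ _ hu) hπ
  · right
    have : u * π + 3 = (u + 1) * π - (π - 3) := by ring
    rw [this]; exact Ideal.sub_mem _ (Ideal.mul_mem_right _ _ hu) hπ
  · left
    have : u * π - 3 = (u + 1) * π - (π + 3) := by ring
    rw [this]; exact Ideal.sub_mem _ (Ideal.mul_mem_right _ _ hu) hπ

/-- `π ≡ ±3 (mod 𝔭³)`, `2 ∈ 𝔭` ⟹ `πⁿ ≡ ±3 (mod 𝔭³)` for every ODD `n` (`π² ≡ 9 ≡ 1` since `8 ∈ 𝔭³`). [folklore] -/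
private theorem pow_sub_three_mem_or_add_three_mem_of_odd (h2 : (2 : R) ∈ P) {π : R} (hπ : π - 3 ∈ P ^ 3 ∨ π + 3 ∈ P ^ 3)
    {n : ℕ} (hn : Odd n) : π ^ n - 3 ∈ P ^ 3 ∨ π ^ n + 3 ∈ P ^ 3 := by
  have h8 : (8 : R) ∈ P ^ 3 := by
    have := Ideal.pow_mem_pow h2 3
    norm_num at this
    exact this
  have hsq : π ^ 2 - 1 ∈ P ^ 3 := by
    have h9 : π ^ 2 - 9 ∈ P ^ 3 := by
      have : π ^ 2 - 9 = (π - 3) * (π + 3) := by ring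
      rw [this]
      rcases hπ with h | h
      · exact Ideal.mul_mem_right _ _ h
      · exact Ideal.mul_mem_left _ _ h
    have : π ^ 2 - 1 = (π ^ 2 - 9) + 8 := by ring
    rw [this]; exact Ideal.add_mem _ h9 h8
  obtain ⟨m, rfl⟩ := hn
  have hm : (π ^ 2) ^ m - 1 ∈ P ^ 3 := by
    obtain ⟨t, ht⟩ := sub_dvd_pow_sub_pow (π ^ 2) 1 m
    rw [one_pow] at ht
    rw [ht]; exact Ideal.mul_mem_right _ _ hsq
  have hpow : π ^ (2 * m + 1) = (π ^ 2) ^ m * π := by ring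
  rcases hπ with h | h
  · left
    have : π ^ (2 * m + 1) - 3 = ((π ^ 2) ^ m - 1) * π + (π - 3) := by ring
    rw [this]; exact Ideal.add_mem _ (Ideal.mul_mem_right _ _ hm) h
  · right
    have : π ^ (2 * m + 1) + 3 = ((π ^ 2) ^ m - 1) * π + (π + 3) := by ring
    rw [this]; exact Ideal.add_mem _ (Ideal.mul_mem_right _ _ hm) h

/-- `π ≡ ±3 (mod 𝔭³)` with `2 ∈ 𝔭 ≠ R` ⟹ `π ≠ 0` (else `3 ∈ 𝔭`, so `1 ∈ 𝔭`). [folklore] -/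
private theorem ne_zero_of_sub_three_mem_or_add_three_mem [P.IsPrime] (h2 : (2 : R) ∈ P) {π : R}
    (hπ : π - 3 ∈ P ^ 3 ∨ π + 3 ∈ P ^ 3) : π ≠ 0 := by
  rintro rfl
  have h3 : (3 : R) ∈ P := by
    have hle : P ^ 3 ≤ P := Ideal.pow_le_self (by norm_num)
    rcases hπ with h | h
    · have := hle h
      rw [zero_sub] at this
      exact (Ideal.neg_mem_iff _).mp this
    · rw [zero_add] at h; exact hle h
  have h1 : (1 : R) ∈ P := by
    have : (1 : R) = 3 - 2 := by norm_num
    rw [this]; exact Ideal.sub_mem _ h3 h2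
  exact (Ideal.IsPrime.ne_top inferInstance) ((Ideal.eq_top_iff_one _).mpr h1)

variable [IsDedekindDomain R] [P.IsMaximal]

/-- **`u² ≡ 1 (mod 𝔭³)` for `u ∉ 𝔭`** at a non-zero prime `𝔭` with residue field `𝔽₂` and `2 ∈ 𝔭 ∖ 𝔭²` (the squares of `ℤ₂ˣ` lie in `1 + 8ℤ₂`;
by localisation at `𝔭`, tree `DyadicUnitNotNormFromSqrtTwo.pow_three_dvd_sq_sub_one_of_not_dvd`).
[cite: Serre1973CourseArithmetic, Ch. II §3.3, Thm. 4 (squares in `ℚ₂ˣ`)] -/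
theorem sq_sub_one_mem_pow_three_of_not_mem (hP0 : P ≠ ⊥) (hres : ∀ r : R, r ∈ P ∨ r - 1 ∈ P)
    (h2 : (2 : R) ∈ P) (h2' : (2 : R) ∉ P ^ 2) {u : R} (hu : u ∉ P) : u ^ 2 - 1 ∈ P ^ 3 := by
  obtain ⟨ϖ, -, hresS, hmem⟩ := exists_prime_uniformizer_localizationAtPrime P hP0 hres
  obtain ⟨w, hw⟩ : ϖ ^ 1 ∣ algebraMap R (Localization.AtPrime P) 2 := (hmem 2 1).mp (by rwa [pow_one])
  rw [pow_one, map_ofNat] at hw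
  have hwndvd : ¬ ϖ ∣ w := by
    rintro ⟨w', rfl⟩
    apply h2'
    rw [hmem, map_ofNat, hw]
    exact ⟨w', by ring⟩
  have huS : ¬ ϖ ∣ algebraMap R (Localization.AtPrime P) u := by
    intro h
    apply hu
    have := (hmem u 1).mpr (by rwa [pow_one])
    rwa [pow_one] at this
  have h := pow_three_dvd_sq_sub_one_of_not_dvd hw hwndvd hresS huS
  rw [hmem, map_sub, map_pow, map_one]
  exact h

end Congruences

/-! ## §3b All units `≡ ±1 (mod 𝔭₁³)` from ONE odd-index unit (unit rank one) -/

section Units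

variable {K : Type} [Field K] [NumberField K]

/-- ★ **All units of `K` are `≡ ±1 (mod 𝔭₁³)` from one displayed unit.**  `K` of odd degree and unit rank `1`, `𝔭₁` a non-zero prime of `𝓞_K` with
residue field `𝔽₂` and `2 ∈ 𝔭₁ ∖ 𝔭₁²`; if a unit `ε` with `ε ≡ ±1 (mod 𝔭₁³)` is given such that neither `ε` nor `−ε` is the square of a unit, then EVERY
unit `u` satisfies `u ≡ ±1 (mod 𝔭₁³)`: the units `≡ ±1` form a subgroup containing `−1`, all squares (`u² ≡ 1`) and `ε`, hence everything (att-p3 g42's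
`AmbiguousClass.eq_top_of_rank_eq_one`: `E_K = ±η^ℤ`, `ε = ±η^{odd}`).  (Equivalently: every unit is a local norm from `K(√2)` at `𝔭₁`.)
[cite: NeukirchANT1999, Ch. I §7 Thm. (7.4) (Dirichlet's unit theorem)] [cite: Serre1973CourseArithmetic, Ch. II §3.3, Thm. 4] -/
theorem forall_units_sub_one_mem_or_add_one_mem_of_rank_eq_one (hodd : Odd (Module.finrank ℚ K)) (hrank : rank K = 1)
    (P : Ideal (𝓞 K)) [P.IsMaximal] (hP0 : P ≠ ⊥) (hres : ∀ r : 𝓞 K, r ∈ P ∨ r - 1 ∈ P)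
    (h2 : (2 : 𝓞 K) ∈ P) (h2' : (2 : 𝓞 K) ∉ P ^ 2) {ε : (𝓞 K)ˣ}
    (hε : (ε : 𝓞 K) - 1 ∈ P ^ 3 ∨ (ε : 𝓞 K) + 1 ∈ P ^ 3) (hnsq : ∀ y : (𝓞 K)ˣ, ε ≠ y ^ 2 ∧ ε ≠ -y ^ 2) :
    ∀ u : (𝓞 K)ˣ, (u : 𝓞 K) - 1 ∈ P ^ 3 ∨ (u : 𝓞 K) + 1 ∈ P ^ 3 := by
  -- the subgroup of units `≡ ±1 (mod 𝔭₁³)`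
  set M : Subgroup (𝓞 K)ˣ :=
    { carrier := {u | (u : 𝓞 K) - 1 ∈ P ^ 3 ∨ (u : 𝓞 K) + 1 ∈ P ^ 3}
      mul_mem' := by
        intro u v hu hv
        simp only [Set.mem_setOf_eq, Units.val_mul] at hu hv ⊢
        rcases hu with hu | hu <;> rcases hv with hv | hv
        · left
          have : (u : 𝓞 K) * v - 1 = ((u : 𝓞 K) - 1) * v + (v - 1) := by ring
          rw [this]; exact Ideal.add_mem _ (Ideal.mul_mem_right _ _ hu) hv
        · right
          have : (u : 𝓞 K) * v + 1 = ((u : 𝓞 K) - 1) * v + (v + 1) := by ring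
          rw [this]; exact Ideal.add_mem _ (Ideal.mul_mem_right _ _ hu) hv
        · right
          have : (u : 𝓞 K) * v + 1 = ((u : 𝓞 K) + 1) * v - (v - 1) := by ring
          rw [this]; exact Ideal.sub_mem _ (Ideal.mul_mem_right _ _ hu) hv
        · left
          have : (u : 𝓞 K) * v - 1 = ((u : 𝓞 K) + 1) * v - (v + 1) := by ring
          rw [this]; exact Ideal.sub_mem _ (Ideal.mul_mem_right _ _ hu) hv
      one_mem' := by
        left
        simp
      inv_mem' := by
        intro u hu
        simp only [Set.mem_setOf_eq] at hu ⊢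
        rcases hu with hu | hu
        · left
          have : ((u⁻¹ : (𝓞 K)ˣ) : 𝓞 K) - 1 = -((u⁻¹ : (𝓞 K)ˣ) : 𝓞 K) * ((u : 𝓞 K) - 1) := by
            rw [neg_mul, mul_sub, Units.inv_mul, mul_one]; ring
          rw [this]; exact Ideal.mul_mem_left _ _ hu
        · right
          have : ((u⁻¹ : (𝓞 K)ˣ) : 𝓞 K) + 1 = ((u⁻¹ : (𝓞 K)ˣ) : 𝓞 K) * ((u : 𝓞 K) + 1) := by
            rw [mul_add, Units.inv_mul, mul_one, add_comm]
          rw [this]; exact Ideal.mul_mem_left _ _ hu } with hM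
  have hneg : (-1 : (𝓞 K)ˣ) ∈ M := by
    right
    show ((-1 : (𝓞 K)ˣ) : 𝓞 K) + 1 ∈ P ^ 3
    rw [Units.val_neg, Units.val_one, neg_add_cancel]
    exact Submodule.zero_mem _
  have hpow : ∀ x : (𝓞 K)ˣ, x ^ 2 ^ 1 ∈ M := by
    intro x
    left
    show ((x ^ 2 ^ 1 : (𝓞 K)ˣ) : 𝓞 K) - 1 ∈ P ^ 3
    rw [pow_one, Units.val_pow_eq_pow_val]
    refine sq_sub_one_mem_pow_three_of_not_mem P hP0 hres h2 h2' fun hx => ?_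
    exact (Ideal.IsPrime.ne_top inferInstance) (Ideal.eq_top_of_isUnit_mem _ hx (Units.isUnit x))
  have hεM : ε ∈ M := hε
  have htop := eq_top_of_rank_eq_one hodd hrank M hneg (m := 1) hpow hεM hnsq
  intro u
  have hu : u ∈ M := by rw [htop]; exact Subgroup.mem_top u
  exact hu

end Units

/-! ## §4 Ideals: `I² = J² ⟹ I = J`; the relative norm of `𝔔` with `𝔔² = π𝓞_L` -/

section Ideals

/-- In a Dedekind domain, `I² = J² ⟹ I = J` (unique factorisation of ideals). [cite: NeukirchANT1999, Ch. I §3 Thm. (3.3)] -/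
theorem Ideal.eq_of_sq_eq_sq {T : Type*} [CommRing T] [IsDedekindDomain T] {I J : Ideal T} (h : I ^ 2 = J ^ 2) : I = J := by
  classical
  by_cases hI : I = ⊥
  · rw [hI, ← Ideal.zero_eq_bot, zero_pow two_ne_zero, eq_comm, pow_eq_zero_iff two_ne_zero] at h
    rw [hI, h, Ideal.zero_eq_bot]
  have hJ : J ≠ ⊥ := by
    intro hJ
    rw [hJ, ← Ideal.zero_eq_bot, zero_pow two_ne_zero, pow_eq_zero_iff two_ne_zero] at h
    exact hI h
  have hf : UniqueFactorizationMonoid.normalizedFactors I = UniqueFactorizationMonoid.normalizedFactors J := by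
    have h2 := congrArg UniqueFactorizationMonoid.normalizedFactors h
    rw [UniqueFactorizationMonoid.normalizedFactors_pow, UniqueFactorizationMonoid.normalizedFactors_pow] at h2
    ext p
    have := congrArg (Multiset.count p) h2
    rw [Multiset.count_nsmul, Multiset.count_nsmul] at this
    omega
  rw [← Ideal.prod_normalizedFactors_eq_self hI, ← Ideal.prod_normalizedFactors_eq_self hJ, hf]

variable {K L : Type} [Field K] [NumberField K] [Field L] [NumberField L] [Algebra K L]

/-- `[Frac 𝓞_L : Frac 𝓞_K] = [L : K]` (the exponent in Mathlib's `Ideal.relNorm_algebraMap`, transported along `Frac 𝓞_K ≃ K`, `Frac 𝓞_L ≃ L`;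
same private lemma as in the tree's `FractionalIdealRelNorm` / `QuarticCMFieldTypeNorm`). [folklore] -/
private theorem finrank_fractionRing_ringOfIntegers_eq :
    letI := FractionRing.liftAlgebra (𝓞 K) (FractionRing (𝓞 L))
    Module.finrank (FractionRing (𝓞 K)) (FractionRing (𝓞 L)) = Module.finrank K L := by
  letI := FractionRing.liftAlgebra (𝓞 K) (FractionRing (𝓞 L))
  refine Algebra.finrank_eq_of_equiv_equiv (FractionRing.algEquiv (𝓞 K) K).toRingEquiv
    (FractionRing.algEquiv (𝓞 L) L).toRingEquiv ?_
  ext x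
  exact IsFractionRing.algEquiv_commutes (FractionRing.algEquiv (𝓞 K) K) (FractionRing.algEquiv (𝓞 L) L) _

/-- **`N_{L/K}(𝔔) = (π)` when `𝔔² = π𝓞_L` and `[L : K] = 2`**: `N(𝔔)² = N(π𝓞_L) = (π)^{[L:K]} = (π)²` (Mathlib `Ideal.relNorm_algebraMap`) and
`I² = J² ⟹ I = J`. [cite: NeukirchANT1999, Ch. III §1 (1.6) Prop. (ii) (`N(𝔞𝓞_L) = 𝔞^{[L:K]}`)] -/
theorem relNorm_eq_span_of_sq_eq_span (h2 : Module.finrank K L = 2) {π : 𝓞 K} {Q : Ideal (𝓞 L)}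
    (hQ : Q ^ 2 = Ideal.span {algebraMap (𝓞 K) (𝓞 L) π}) : Ideal.relNorm (𝓞 K) Q = Ideal.span {π} := by
  letI := FractionRing.liftAlgebra (𝓞 K) (FractionRing (𝓞 L))
  apply Ideal.eq_of_sq_eq_sq
  have hmap : Ideal.span {algebraMap (𝓞 K) (𝓞 L) π} = (Ideal.span {π}).map (algebraMap (𝓞 K) (𝓞 L)) := by
    rw [Ideal.map_span, Set.image_singleton]
  rw [← map_pow, hQ, hmap, Ideal.relNorm_algebraMap, finrank_fractionRing_ringOfIntegers_eq, h2]

/-- `N_{L/K}` of elements vs. Mathlib's `Algebra.intNorm` on `𝓞_L`: `(intNorm δ : K) = N_{L/K}(δ : L)`. [folklore] -/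
private theorem coe_intNorm_eq_norm (δ : 𝓞 L) :
    ((Algebra.intNorm (𝓞 K) (𝓞 L) δ : 𝓞 K) : K) = Algebra.norm K (δ : L) :=
  Algebra.algebraMap_intNorm (A := 𝓞 K) (K := K) (L := L) (B := 𝓞 L) δ

end Ideals

/-! ## §5 The certificate -/

section Main

variable {K L : Type} [Field K] [NumberField K] [Field L] [NumberField L] [Algebra K L]

/-- **KEY LEMMA (the genus character at `𝔭₁` kills `w·b²·πⁿ`).**  `L/K` Galois quadratic with `s² = 2`, `s ∉ K`; `𝔭₁` a non-zero prime of `𝓞_K` with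
residue field `𝔽₂`, `2 ∈ 𝔭₁ ∖ 𝔭₁²`; `π ≡ ±3 (mod 𝔭₁³)`.  Then for `δ ∈ 𝓞_L`, `b ∈ 𝓞_K ∖ 0`, a unit `w ≡ ±1 (mod 𝔭₁³)` and `n` odd:
`N_{L/K}(δ) ≠ w b² πⁿ` — since `N(δ) = a² − 2c²` (`δ = a + cs`) and `(a/b)² − 2(c/b)² = wπⁿ ≡ ±3 (mod 𝔭₁³)` contradicts the tree's dyadic non-norm
lemma («`(wπⁿ, 2)_{𝔭₁} = −1`»). [cite: Serre1973CourseArithmetic, Ch. III §1.2, Thm. 1] [cite: Omeara1963, §63B (63:10)] -/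
theorem intNorm_ne_unit_mul_sq_mul_pow [IsGalois K L] (h2 : Module.finrank K L = 2) {s : L} (hs : s ^ 2 = 2)
    (hsK : ∀ k : K, algebraMap K L k ≠ s)
    (P : Ideal (𝓞 K)) [P.IsMaximal] (hP0 : P ≠ ⊥) (hres : ∀ r : 𝓞 K, r ∈ P ∨ r - 1 ∈ P)
    (h2P : (2 : 𝓞 K) ∈ P) (h2P' : (2 : 𝓞 K) ∉ P ^ 2) {π : 𝓞 K} (hπ : π - 3 ∈ P ^ 3 ∨ π + 3 ∈ P ^ 3)
    (δ : 𝓞 L) {b : 𝓞 K} (hb : b ≠ 0) {w : (𝓞 K)ˣ} (hw : (w : 𝓞 K) - 1 ∈ P ^ 3 ∨ (w : 𝓞 K) + 1 ∈ P ^ 3)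
    {n : ℕ} (hn : Odd n) :
    Algebra.intNorm (𝓞 K) (𝓞 L) δ ≠ (w : 𝓞 K) * b ^ 2 * π ^ n := by
  intro heq
  have hε := mul_sub_three_mem_or_add_three_mem P hw (pow_sub_three_mem_or_add_three_mem_of_odd P h2P hπ hn)
  obtain ⟨a, c, hac⟩ := exists_eq_add_mul_of_finrank_eq_two h2 hsK (δ : L)
  have hN : ((Algebra.intNorm (𝓞 K) (𝓞 L) δ : 𝓞 K) : K) = a ^ 2 - 2 * c ^ 2 := by
    rw [coe_intNorm_eq_norm, hac, Algebra.norm_add_mul_eq_sq_sub_two_mul_sq h2 hs hsK]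
  have hbK : ((b : 𝓞 K) : K) ≠ 0 := by
    rw [Ne, RingOfIntegers.coe_eq_zero_iff]; exact hb
  have hxy : (a / b) ^ 2 - 2 * (c / b) ^ 2 = algebraMap (𝓞 K) K ((w : 𝓞 K) * π ^ n) := by
    have h1 : a ^ 2 - 2 * c ^ 2 = ((w : 𝓞 K) : K) * (b : K) ^ 2 * (π : K) ^ n := by
      rw [← hN, heq]; push_cast; ring
    rw [← RingOfIntegers.coe_eq_algebraMap]
    push_cast
    field_simp
    linear_combination h1
  rcases hε with h | h
  · exact forall_sq_sub_two_mul_sq_ne_of_sub_three_mem_pow_three P K hP0 hres h2P h2P' h (a / b) (c / b) hxy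
  · exact forall_sq_sub_two_mul_sq_ne_of_add_three_mem_pow_three P K hP0 hres h2P h2P' h (a / b) (c / b) hxy

/-- ★★ **THE GENUS-CHARACTER CERTIFICATE.**  `K ⊆ L` number fields, `L/K` Galois of degree `2`, `s ∈ L ∖ K` with `s² = 2`; `h_K` odd; `𝔭₁` a non-zero
prime of `𝓞_K` with residue field `𝔽₂` and `2 ∈ 𝔭₁ ∖ 𝔭₁²`; every unit of `K` is `≡ ±1 (mod 𝔭₁³)`; `#(Cl_L/Cl_L²) ≤ 2`; `π ∈ 𝓞_K` with `π ≡ ±3 (mod 𝔭₁³)`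
and an ideal `𝔔` of `𝓞_L` with `𝔔² = π𝓞_L`.  THEN **`𝔔` is not principal and `4 ∤ h_L`.**  (i) `𝔔 = (δ)` would give `(π) = N(𝔔) = (Nδ)`, `Nδ = wπ`;
(ii) `[𝔔]` is the unique element of order `2`; if `4 ∣ h_L` it is a square `c²`, `𝔅 ∈ c` integral, `𝔅²𝔔 = (δ)`, `N(𝔅)²(π) = (Nδ)`, and with `h = h_K` odd,
`N(𝔅)^h = (b)`: `N(δ^h) = w b² π^h`.  Both contradict the key lemma. [cite: Gras2003, IV.4 (genus theory; ambiguous classes and genus characters)]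
[cite: Serre1973CourseArithmetic, Ch. III §1.2, Thm. 1] [cite: NeukirchANT1999, Ch. III §1 (1.6) (relative norm of ideals)] -/
theorem not_isPrincipal_and_not_four_dvd_of_genusCert [IsGalois K L] (h2 : Module.finrank K L = 2) {s : L} (hs : s ^ 2 = 2)
    (hsK : ∀ k : K, algebraMap K L k ≠ s) (hodd : Odd (classNumber K))
    (P : Ideal (𝓞 K)) [P.IsMaximal] (hP0 : P ≠ ⊥) (hres : ∀ r : 𝓞 K, r ∈ P ∨ r - 1 ∈ P)
    (h2P : (2 : 𝓞 K) ∈ P) (h2P' : (2 : 𝓞 K) ∉ P ^ 2)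
    (hunits : ∀ u : (𝓞 K)ˣ, (u : 𝓞 K) - 1 ∈ P ^ 3 ∨ (u : 𝓞 K) + 1 ∈ P ^ 3)
    (hrank : Nat.card (ClassGroup (𝓞 L) ⧸ (powMonoidHom 2 : ClassGroup (𝓞 L) →* ClassGroup (𝓞 L)).range) ≤ 2)
    {π : 𝓞 K} (hπ : π - 3 ∈ P ^ 3 ∨ π + 3 ∈ P ^ 3)
    {Q : Ideal (𝓞 L)} (hQ : Q ^ 2 = Ideal.span {algebraMap (𝓞 K) (𝓞 L) π}) :
    ¬ Q.IsPrincipal ∧ ¬ 4 ∣ Nat.card (ClassGroup (𝓞 L)) := by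
  classical
  have hπ0 : π ≠ 0 := ne_zero_of_sub_three_mem_or_add_three_mem P h2P hπ
  have hNQ : Ideal.relNorm (𝓞 K) Q = Ideal.span {π} := relNorm_eq_span_of_sq_eq_span h2 hQ
  have hQ0 : Q ≠ ⊥ := by
    intro h
    rw [h, ← Ideal.zero_eq_bot, zero_pow two_ne_zero, Ideal.zero_eq_bot, eq_comm, Ideal.span_singleton_eq_bot,
      map_eq_zero_iff _ (RingOfIntegers.algebraMap.injective K L)] at hQ
    exact hπ0 hQ
  -- (i) `𝔔` is not principal
  have hQnp : ¬ Q.IsPrincipal := by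
    intro hprin
    haveI := hprin
    obtain ⟨δ, hδ⟩ := Submodule.IsPrincipal.principal Q
    rw [Ideal.submodule_span_eq] at hδ
    rw [hδ, Ideal.relNorm_singleton, Ideal.span_singleton_eq_span_singleton] at hNQ
    obtain ⟨u, hu⟩ := hNQ.symm
    -- `π · u = N δ`
    refine intNorm_ne_unit_mul_sq_mul_pow h2 hs hsK P hP0 hres h2P h2P' hπ δ one_ne_zero (hunits u) odd_one ?_
    rw [← hu]; ring
  refine ⟨hQnp, fun h4 => ?_⟩
  -- (ii) the class `q = [𝔔]` has order `2`
  set Qnz : (Ideal (𝓞 L))⁰ := ⟨Q, mem_nonZeroDivisors_of_ne_zero (by rwa [Ne, Ideal.zero_eq_bot])⟩ with hQnz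
  have hq1 : ClassGroup.mk0 Qnz ≠ 1 := by
    rw [hQnz, Ne, ClassGroup.mk0_eq_one_iff]; exact hQnp
  have hπL0 : Ideal.span {algebraMap (𝓞 K) (𝓞 L) π} ≠ ⊥ := by
    rw [Ne, Ideal.span_singleton_eq_bot, map_eq_zero_iff _ (RingOfIntegers.algebraMap.injective K L)]; exact hπ0
  have hq2 : ClassGroup.mk0 Qnz ^ 2 = 1 := by
    have hval : (Qnz ^ 2 : (Ideal (𝓞 L))⁰) = ⟨Ideal.span {algebraMap (𝓞 K) (𝓞 L) π},
        mem_nonZeroDivisors_of_ne_zero (by rwa [Ne, Ideal.zero_eq_bot])⟩ := by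
      apply Subtype.ext
      simp [hQnz, hQ]
    rw [← map_pow, hval, ClassGroup.mk0_eq_one_iff]
    exact ⟨⟨algebraMap (𝓞 K) (𝓞 L) π, by rw [Ideal.submodule_span_eq]⟩⟩
  -- a class `c` with `c² = q`, represented by an integral `𝔅`
  obtain ⟨c, hc⟩ := exists_sq_eq_of_four_dvd_natCard hrank h4 hq2 hq1
  obtain ⟨B, hB⟩ := ClassGroup.mk0_surjective c
  -- `𝔅² 𝔔` is principal
  have hprin : ClassGroup.mk0 (B ^ 2 * Qnz) = 1 := by
    rw [map_mul, map_pow, hB, hc, ← sq, hq2]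
  have hval : (B ^ 2 * Qnz : (Ideal (𝓞 L))⁰) = ⟨(B : Ideal (𝓞 L)) ^ 2 * Q,
      mem_nonZeroDivisors_of_ne_zero (mul_ne_zero (pow_ne_zero _ (nonZeroDivisors.ne_zero B.2))
        (by rwa [Ne, Ideal.zero_eq_bot]))⟩ := by
    apply Subtype.ext
    simp [hQnz]
  rw [hval, ClassGroup.mk0_eq_one_iff] at hprin
  haveI := hprin
  obtain ⟨δ, hδ⟩ := Submodule.IsPrincipal.principal ((B : Ideal (𝓞 L)) ^ 2 * Q)
  rw [Ideal.submodule_span_eq] at hδ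
  -- relative norms: `N(𝔅)² · (π) = (N δ)`
  have hN := congrArg (Ideal.relNorm (𝓞 K)) hδ
  rw [map_mul, map_pow, hNQ, Ideal.relNorm_singleton] at hN
  -- `N(𝔅)^h = (b)` with `h = h_K` odd
  have hB0 : Ideal.relNorm (𝓞 K) (B : Ideal (𝓞 L)) ≠ ⊥ := by
    rw [Ne, Ideal.relNorm_eq_bot_iff]
    exact nonZeroDivisors.ne_zero B.2
  set NB : (Ideal (𝓞 K))⁰ := ⟨Ideal.relNorm (𝓞 K) (B : Ideal (𝓞 L)),
    mem_nonZeroDivisors_of_ne_zero (by rwa [Ne, Ideal.zero_eq_bot])⟩ with hNB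
  have hh : ClassGroup.mk0 (NB ^ classNumber K) = 1 := by
    rw [map_pow, classNumber]
    exact pow_card_eq_one
  have hvalB : (NB ^ classNumber K : (Ideal (𝓞 K))⁰) = ⟨Ideal.relNorm (𝓞 K) (B : Ideal (𝓞 L)) ^ classNumber K,
      mem_nonZeroDivisors_of_ne_zero (pow_ne_zero _ (by rwa [Ne, Ideal.zero_eq_bot]))⟩ := by
    apply Subtype.ext
    simp [hNB]
  rw [hvalB, ClassGroup.mk0_eq_one_iff] at hh
  haveI := hh
  obtain ⟨b, hb⟩ := Submodule.IsPrincipal.principal (Ideal.relNorm (𝓞 K) (B : Ideal (𝓞 L)) ^ classNumber K)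
  rw [Ideal.submodule_span_eq] at hb
  have hb0 : b ≠ 0 := by
    intro h0
    rw [h0, Ideal.span_singleton_eq_bot.mpr rfl] at hb
    exact pow_ne_zero _ (by rwa [Ne, ← Ideal.zero_eq_bot] at hB0) (hb.trans Ideal.zero_eq_bot.symm)
  -- raise `N(𝔅)² (π) = (Nδ)` to the `h`-th power
  have hNh : (Ideal.relNorm (𝓞 K) (B : Ideal (𝓞 L)) ^ 2 * Ideal.span {π}) ^ classNumber K =
      Ideal.span {Algebra.intNorm (𝓞 K) (𝓞 L) δ} ^ classNumber K := by rw [hN]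
  rw [mul_pow, ← pow_mul, mul_comm 2, pow_mul, hb, Ideal.span_singleton_pow, Ideal.span_singleton_pow,
    Ideal.span_singleton_pow, Ideal.span_singleton_mul_span_singleton, ← map_pow,
    Ideal.span_singleton_eq_span_singleton] at hNh
  obtain ⟨u, hu⟩ := hNh
  exact intNorm_ne_unit_mul_sq_mul_pow h2 hs hsK P hP0 hres h2P h2P' hπ (δ ^ classNumber K) hb0 (hunits u) hodd
    (by rw [← hu]; ring)

/-- ★★ **`ord₂ h_L = 1`** under the genus-character certificate: `2 ∣ h_L` (the class of `𝔔` has order `2`) and `4 ∤ h_L`.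
[cite: Gras2003, IV.4] [cite: Serre1973CourseArithmetic, Ch. III §1.2, Thm. 1] -/
theorem padicValNat_two_card_classGroup_eq_one_of_genusCert [IsGalois K L] (h2 : Module.finrank K L = 2) {s : L}
    (hs : s ^ 2 = 2) (hsK : ∀ k : K, algebraMap K L k ≠ s) (hodd : Odd (classNumber K))
    (P : Ideal (𝓞 K)) [P.IsMaximal] (hP0 : P ≠ ⊥) (hres : ∀ r : 𝓞 K, r ∈ P ∨ r - 1 ∈ P)
    (h2P : (2 : 𝓞 K) ∈ P) (h2P' : (2 : 𝓞 K) ∉ P ^ 2)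
    (hunits : ∀ u : (𝓞 K)ˣ, (u : 𝓞 K) - 1 ∈ P ^ 3 ∨ (u : 𝓞 K) + 1 ∈ P ^ 3)
    (hrank : Nat.card (ClassGroup (𝓞 L) ⧸ (powMonoidHom 2 : ClassGroup (𝓞 L) →* ClassGroup (𝓞 L)).range) ≤ 2)
    {π : 𝓞 K} (hπ : π - 3 ∈ P ^ 3 ∨ π + 3 ∈ P ^ 3)
    {Q : Ideal (𝓞 L)} (hQ : Q ^ 2 = Ideal.span {algebraMap (𝓞 K) (𝓞 L) π}) :
    padicValNat 2 (Nat.card (ClassGroup (𝓞 L))) = 1 := by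
  classical
  obtain ⟨hQnp, h4⟩ := not_isPrincipal_and_not_four_dvd_of_genusCert h2 hs hsK hodd P hP0 hres h2P h2P' hunits hrank hπ hQ
  have hπ0 : π ≠ 0 := ne_zero_of_sub_three_mem_or_add_three_mem P h2P hπ
  have hQ0 : Q ≠ ⊥ := by
    intro h
    rw [h, ← Ideal.zero_eq_bot, zero_pow two_ne_zero, Ideal.zero_eq_bot, eq_comm, Ideal.span_singleton_eq_bot,
      map_eq_zero_iff _ (RingOfIntegers.algebraMap.injective K L)] at hQ
    exact hπ0 hQ
  set Qnz : (Ideal (𝓞 L))⁰ := ⟨Q, mem_nonZeroDivisors_of_ne_zero (by rwa [Ne, Ideal.zero_eq_bot])⟩ with hQnz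
  have hq1 : ClassGroup.mk0 Qnz ≠ 1 := by
    rw [hQnz, Ne, ClassGroup.mk0_eq_one_iff]; exact hQnp
  have hq2 : ClassGroup.mk0 Qnz ^ 2 = 1 := by
    have hval : (Qnz ^ 2 : (Ideal (𝓞 L))⁰) = ⟨Ideal.span {algebraMap (𝓞 K) (𝓞 L) π},
        mem_nonZeroDivisors_of_ne_zero (by
          rw [Ne, Ideal.zero_eq_bot, Ideal.span_singleton_eq_bot, map_eq_zero_iff _ (RingOfIntegers.algebraMap.injective K L)]
          exact hπ0)⟩ := by
      apply Subtype.ext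
      simp [hQnz, hQ]
    rw [← map_pow, hval, ClassGroup.mk0_eq_one_iff]
    exact ⟨⟨algebraMap (𝓞 K) (𝓞 L) π, by rw [Ideal.submodule_span_eq]⟩⟩
  have h2dvd : 2 ∣ Nat.card (ClassGroup (𝓞 L)) := two_dvd_natCard_of_sq_eq_one hq2 hq1
  have hne : Nat.card (ClassGroup (𝓞 L)) ≠ 0 := Nat.card_pos.ne'
  haveI : Fact (Nat.Prime 2) := ⟨Nat.prime_two⟩
  have hge : 1 ≤ padicValNat 2 (Nat.card (ClassGroup (𝓞 L))) :=
    (padicValNat_dvd_iff_le hne).mp (by rwa [pow_one])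
  have hlt : ¬ 2 ≤ padicValNat 2 (Nat.card (ClassGroup (𝓞 L))) := by
    intro h
    exact h4 ((padicValNat_dvd_iff_le hne).mpr h)
  omega

end Main

/-! ## §6 The certificate for an ARBITRARY ideal of order two (both genus regimes) — appended by the same seat (att-p3 g43)

The §5 certificate takes `𝔔` with `𝔔² = π𝓞_L` (an ambiguous ideal: `𝔔 = 𝔓₂^k`).  When every unit of `K` is the norm of a UNIT of `L` the class of order `2`
is `[𝔓₂]` and §5 is complete; in the other regime `𝔓₂` is principal, the class of order `2` contains no ambiguous ideal, and the same argument runs with ANY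
ideal `𝔔` such that `𝔔²` is principal and `N_{L/K}(𝔔) = (α)` with `α ≡ ±3 (mod 𝔭₁³)` — e.g. a prime of `L` above a split prime `𝔮 = (α)` of `K`.  The
companion file `IwasawaTheory/ClassNumberPExpLayerOneEqOneOfGenusCertificate` (§4 there) turns this into base-field data: `x, y, α ∈ 𝓞_K` with
`x² − 2y² = uα²`, `(α, x) = (α, 2) = 1`, `α ≡ ±3 (mod 𝔭₁³)`, `𝔔 := (x + y√2, α)`. -/

section General

variable {K L : Type} [Field K] [NumberField K] [Field L] [NumberField L] [Algebra K L]

/-- ★★ **THE GENUS-CHARACTER CERTIFICATE, general ideal.**  Same setting as `not_isPrincipal_and_not_four_dvd_of_genusCert` (`L/K` Galois quadratic, `s² = 2`,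
`s ∉ K`, `h_K` odd, `𝔭₁` with residue field `𝔽₂` and `2 ∈ 𝔭₁ ∖ 𝔭₁²`, all units `≡ ±1 (mod 𝔭₁³)`, `#(Cl_L/Cl_L²) ≤ 2`), but for ANY ideal `𝔔` of `𝓞_L` with
`𝔔²` principal and `N_{L/K}(𝔔) = (α)`, `α ≡ ±3 (mod 𝔭₁³)`: then **`𝔔` is not principal and `4 ∤ h_L`**. [cite: Gras2003, IV.4 (genus theory; ambiguous classes and genus characters)]
[cite: Serre1973CourseArithmetic, Ch. III §1.2, Thm. 1] [cite: NeukirchANT1999, Ch. III §1 (1.6)] -/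
theorem not_isPrincipal_and_not_four_dvd_of_genusCert_of_relNorm_eq [IsGalois K L] (h2 : Module.finrank K L = 2) {s : L}
    (hs : s ^ 2 = 2) (hsK : ∀ k : K, algebraMap K L k ≠ s) (hodd : Odd (classNumber K))
    (P : Ideal (𝓞 K)) [P.IsMaximal] (hP0 : P ≠ ⊥) (hres : ∀ r : 𝓞 K, r ∈ P ∨ r - 1 ∈ P)
    (h2P : (2 : 𝓞 K) ∈ P) (h2P' : (2 : 𝓞 K) ∉ P ^ 2)
    (hunits : ∀ u : (𝓞 K)ˣ, (u : 𝓞 K) - 1 ∈ P ^ 3 ∨ (u : 𝓞 K) + 1 ∈ P ^ 3)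
    (hrank : Nat.card (ClassGroup (𝓞 L) ⧸ (powMonoidHom 2 : ClassGroup (𝓞 L) →* ClassGroup (𝓞 L)).range) ≤ 2)
    {α : 𝓞 K} (hα : α - 3 ∈ P ^ 3 ∨ α + 3 ∈ P ^ 3)
    {Q : Ideal (𝓞 L)} (hNQ : Ideal.relNorm (𝓞 K) Q = Ideal.span {α}) (hQ2 : (Q ^ 2).IsPrincipal) :
    ¬ Q.IsPrincipal ∧ ¬ 4 ∣ Nat.card (ClassGroup (𝓞 L)) := by
  classical
  have hα0 : α ≠ 0 := ne_zero_of_sub_three_mem_or_add_three_mem P h2P hα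
  have hQ0 : Q ≠ ⊥ := by
    intro h
    rw [h, Ideal.relNorm_bot, eq_comm, Ideal.span_singleton_eq_bot] at hNQ
    exact hα0 hNQ
  -- (i) `𝔔` is not principal
  have hQnp : ¬ Q.IsPrincipal := by
    intro hprin
    haveI := hprin
    obtain ⟨δ, hδ⟩ := Submodule.IsPrincipal.principal Q
    rw [Ideal.submodule_span_eq] at hδ
    have hN := hNQ
    rw [hδ, Ideal.relNorm_singleton, Ideal.span_singleton_eq_span_singleton] at hN
    obtain ⟨u, hu⟩ := hN.symm
    refine intNorm_ne_unit_mul_sq_mul_pow h2 hs hsK P hP0 hres h2P h2P' hα δ one_ne_zero (hunits u) odd_one ?_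
    rw [← hu]; ring
  refine ⟨hQnp, fun h4 => ?_⟩
  -- (ii) the class `q = [𝔔]` has order `2`
  set Qnz : (Ideal (𝓞 L))⁰ := ⟨Q, mem_nonZeroDivisors_of_ne_zero (by rwa [Ne, Ideal.zero_eq_bot])⟩ with hQnz
  have hq1 : ClassGroup.mk0 Qnz ≠ 1 := by
    rw [hQnz, Ne, ClassGroup.mk0_eq_one_iff]; exact hQnp
  have hq2 : ClassGroup.mk0 Qnz ^ 2 = 1 := by
    have hval : (Qnz ^ 2 : (Ideal (𝓞 L))⁰) = ⟨Q ^ 2,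
        mem_nonZeroDivisors_of_ne_zero (pow_ne_zero _ (by rwa [Ne, Ideal.zero_eq_bot]))⟩ := by
      apply Subtype.ext
      simp [hQnz]
    rw [← map_pow, hval, ClassGroup.mk0_eq_one_iff]
    exact hQ2
  obtain ⟨c, hc⟩ := exists_sq_eq_of_four_dvd_natCard hrank h4 hq2 hq1
  obtain ⟨B, hB⟩ := ClassGroup.mk0_surjective c
  have hprin : ClassGroup.mk0 (B ^ 2 * Qnz) = 1 := by
    rw [map_mul, map_pow, hB, hc, ← sq, hq2]
  have hval : (B ^ 2 * Qnz : (Ideal (𝓞 L))⁰) = ⟨(B : Ideal (𝓞 L)) ^ 2 * Q,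
      mem_nonZeroDivisors_of_ne_zero (mul_ne_zero (pow_ne_zero _ (nonZeroDivisors.ne_zero B.2))
        (by rwa [Ne, Ideal.zero_eq_bot]))⟩ := by
    apply Subtype.ext
    simp [hQnz]
  rw [hval, ClassGroup.mk0_eq_one_iff] at hprin
  haveI := hprin
  obtain ⟨δ, hδ⟩ := Submodule.IsPrincipal.principal ((B : Ideal (𝓞 L)) ^ 2 * Q)
  rw [Ideal.submodule_span_eq] at hδ
  have hN := congrArg (Ideal.relNorm (𝓞 K)) hδ
  rw [map_mul, map_pow, hNQ, Ideal.relNorm_singleton] at hN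
  have hB0 : Ideal.relNorm (𝓞 K) (B : Ideal (𝓞 L)) ≠ ⊥ := by
    rw [Ne, Ideal.relNorm_eq_bot_iff]
    exact nonZeroDivisors.ne_zero B.2
  set NB : (Ideal (𝓞 K))⁰ := ⟨Ideal.relNorm (𝓞 K) (B : Ideal (𝓞 L)),
    mem_nonZeroDivisors_of_ne_zero (by rwa [Ne, Ideal.zero_eq_bot])⟩ with hNB
  have hh : ClassGroup.mk0 (NB ^ classNumber K) = 1 := by
    rw [map_pow, classNumber]
    exact pow_card_eq_one
  have hvalB : (NB ^ classNumber K : (Ideal (𝓞 K))⁰) = ⟨Ideal.relNorm (𝓞 K) (B : Ideal (𝓞 L)) ^ classNumber K,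
      mem_nonZeroDivisors_of_ne_zero (pow_ne_zero _ (by rwa [Ne, Ideal.zero_eq_bot]))⟩ := by
    apply Subtype.ext
    simp [hNB]
  rw [hvalB, ClassGroup.mk0_eq_one_iff] at hh
  haveI := hh
  obtain ⟨b, hb⟩ := Submodule.IsPrincipal.principal (Ideal.relNorm (𝓞 K) (B : Ideal (𝓞 L)) ^ classNumber K)
  rw [Ideal.submodule_span_eq] at hb
  have hb0 : b ≠ 0 := by
    intro h0
    rw [h0, Ideal.span_singleton_eq_bot.mpr rfl] at hb
    exact pow_ne_zero _ (by rwa [Ne, ← Ideal.zero_eq_bot] at hB0) (hb.trans Ideal.zero_eq_bot.symm)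
  have hNh : (Ideal.relNorm (𝓞 K) (B : Ideal (𝓞 L)) ^ 2 * Ideal.span {α}) ^ classNumber K =
      Ideal.span {Algebra.intNorm (𝓞 K) (𝓞 L) δ} ^ classNumber K := by rw [hN]
  rw [mul_pow, ← pow_mul, mul_comm 2, pow_mul, hb, Ideal.span_singleton_pow, Ideal.span_singleton_pow,
    Ideal.span_singleton_pow, Ideal.span_singleton_mul_span_singleton, ← map_pow,
    Ideal.span_singleton_eq_span_singleton] at hNh
  obtain ⟨u, hu⟩ := hNh
  exact intNorm_ne_unit_mul_sq_mul_pow h2 hs hsK P hP0 hres h2P h2P' hα (δ ^ classNumber K) hb0 (hunits u) hodd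
    (by rw [← hu]; ring)

/-- ★★ **`ord₂ h_L = 1`** from the general certificate (`2 ∣ h_L` by the class of `𝔔`, `4 ∤ h_L`). [cite: Gras2003, IV.4] [cite: Serre1973CourseArithmetic, Ch. III §1.2, Thm. 1] -/
theorem padicValNat_two_card_classGroup_eq_one_of_genusCert_of_relNorm_eq [IsGalois K L] (h2 : Module.finrank K L = 2) {s : L}
    (hs : s ^ 2 = 2) (hsK : ∀ k : K, algebraMap K L k ≠ s) (hodd : Odd (classNumber K))
    (P : Ideal (𝓞 K)) [P.IsMaximal] (hP0 : P ≠ ⊥) (hres : ∀ r : 𝓞 K, r ∈ P ∨ r - 1 ∈ P)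
    (h2P : (2 : 𝓞 K) ∈ P) (h2P' : (2 : 𝓞 K) ∉ P ^ 2)
    (hunits : ∀ u : (𝓞 K)ˣ, (u : 𝓞 K) - 1 ∈ P ^ 3 ∨ (u : 𝓞 K) + 1 ∈ P ^ 3)
    (hrank : Nat.card (ClassGroup (𝓞 L) ⧸ (powMonoidHom 2 : ClassGroup (𝓞 L) →* ClassGroup (𝓞 L)).range) ≤ 2)
    {α : 𝓞 K} (hα : α - 3 ∈ P ^ 3 ∨ α + 3 ∈ P ^ 3)
    {Q : Ideal (𝓞 L)} (hNQ : Ideal.relNorm (𝓞 K) Q = Ideal.span {α}) (hQ2 : (Q ^ 2).IsPrincipal) :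
    padicValNat 2 (Nat.card (ClassGroup (𝓞 L))) = 1 := by
  classical
  obtain ⟨hQnp, h4⟩ := not_isPrincipal_and_not_four_dvd_of_genusCert_of_relNorm_eq h2 hs hsK hodd P hP0 hres h2P h2P' hunits
    hrank hα hNQ hQ2
  have hα0 : α ≠ 0 := ne_zero_of_sub_three_mem_or_add_three_mem P h2P hα
  have hQ0 : Q ≠ ⊥ := by
    intro h
    rw [h, Ideal.relNorm_bot, eq_comm, Ideal.span_singleton_eq_bot] at hNQ
    exact hα0 hNQ
  set Qnz : (Ideal (𝓞 L))⁰ := ⟨Q, mem_nonZeroDivisors_of_ne_zero (by rwa [Ne, Ideal.zero_eq_bot])⟩ with hQnz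
  have hq1 : ClassGroup.mk0 Qnz ≠ 1 := by
    rw [hQnz, Ne, ClassGroup.mk0_eq_one_iff]; exact hQnp
  have hq2 : ClassGroup.mk0 Qnz ^ 2 = 1 := by
    have hval : (Qnz ^ 2 : (Ideal (𝓞 L))⁰) = ⟨Q ^ 2,
        mem_nonZeroDivisors_of_ne_zero (pow_ne_zero _ (by rwa [Ne, Ideal.zero_eq_bot]))⟩ := by
      apply Subtype.ext
      simp [hQnz]
    rw [← map_pow, hval, ClassGroup.mk0_eq_one_iff]
    exact hQ2
  have h2dvd : 2 ∣ Nat.card (ClassGroup (𝓞 L)) := two_dvd_natCard_of_sq_eq_one hq2 hq1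
  have hne : Nat.card (ClassGroup (𝓞 L)) ≠ 0 := Nat.card_pos.ne'
  haveI : Fact (Nat.Prime 2) := ⟨Nat.prime_two⟩
  have hge : 1 ≤ padicValNat 2 (Nat.card (ClassGroup (𝓞 L))) :=
    (padicValNat_dvd_iff_le hne).mp (by rwa [pow_one])
  have hlt : ¬ 2 ≤ padicValNat 2 (Nat.card (ClassGroup (𝓞 L))) := by
    intro h
    exact h4 ((padicValNat_dvd_iff_le hne).mpr h)
  omega

/-- **The ideal `𝔔 = (δ, α)` with `𝔔² = (δ)` and `N_{L/K}(𝔔) = (α)`** from base-field data: `δ ∈ 𝓞_L` with `N_{L/K}(δ) = u·α²` (`u` a unit of `K`), Bézout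
witnesses `mα + nx = 1` with `2x = δ + δ'`-type relation replaced by the hypothesis `2·xL·δ = δ² + N(δ)` for some `xL ∈ 𝓞_L` (e.g. `δ = x + y√2`, `xL = x`),
and `m'α² + 2n' = 1` (`α` odd).  Pure ideal arithmetic: `𝔔² = (δ², δα, α²) = (δ)`; `N(𝔔)² = (Nδ) = (α)²`. [cite: NeukirchANT1999, Ch. I §3 (ideal arithmetic in Dedekind domains) and Ch. III §1 (1.6)] -/
theorem sq_span_pair_eq_and_relNorm_eq {δ : 𝓞 L} {α x m n m' n' : 𝓞 K} {u : (𝓞 K)ˣ}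
    (hN : Algebra.intNorm (𝓞 K) (𝓞 L) δ = (u : 𝓞 K) * α ^ 2)
    {xL : 𝓞 L} (hxL : xL = algebraMap (𝓞 K) (𝓞 L) x)
    (htr : 2 * xL * δ = δ ^ 2 + algebraMap (𝓞 K) (𝓞 L) (Algebra.intNorm (𝓞 K) (𝓞 L) δ))
    (hbez : m * α + n * x = 1) (hbez' : m' * α ^ 2 + n' * 2 = 1) :
    (Ideal.span {δ, algebraMap (𝓞 K) (𝓞 L) α}) ^ 2 = Ideal.span {δ} ∧
      Ideal.relNorm (𝓞 K) (Ideal.span {δ, algebraMap (𝓞 K) (𝓞 L) α}) = Ideal.span {α} := by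
  classical
  set f := algebraMap (𝓞 K) (𝓞 L) with hf
  set Q : Ideal (𝓞 L) := Ideal.span {δ, f α} with hQ
  -- `𝔔² = (δ)`
  have hsq : Q ^ 2 = Ideal.span {δ} := by
    apply le_antisymm
    · -- generators of `𝔔²` are products of two generators, each divisible by `δ` (`α² = u⁻¹ N δ ∈ (δ)` via `δ ∣ Nδ`)
      rw [pow_two, hQ, Ideal.span_pair_mul_span_pair, Ideal.span_le]
      have hαα : f α * f α ∈ Ideal.span {δ} := by
        rw [Ideal.mem_span_singleton]
        -- `α² = u⁻¹ · N δ` and `N δ = δ · (2 xL - δ)`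
        have hNd : f (Algebra.intNorm (𝓞 K) (𝓞 L) δ) = δ * (2 * xL - δ) := by linear_combination -htr
        refine ⟨(2 * xL - δ) * f ((u⁻¹ : (𝓞 K)ˣ) : 𝓞 K), ?_⟩
        have : f α * f α = f ((u⁻¹ : (𝓞 K)ˣ) : 𝓞 K) * f (Algebra.intNorm (𝓞 K) (𝓞 L) δ) := by
          rw [← map_mul, ← map_mul, hN, ← mul_assoc, Units.inv_mul, one_mul, sq]
        rw [this, hNd]; ring
      intro z hz
      simp only [Set.mem_insert_iff, Set.mem_singleton_iff] at hz
      rcases hz with rfl | rfl | rfl | rfl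
      · exact Ideal.mem_span_singleton.mpr ⟨δ, by ring⟩
      · exact Ideal.mem_span_singleton.mpr ⟨f α, by ring⟩
      · exact Ideal.mem_span_singleton.mpr ⟨f α, by ring⟩
      · exact hαα
    · -- `δ ∈ 𝔔²`: `δ = m'α²δ + n'(2δ)` and `2δ = 2(mα + nx)δ = 2mαδ + n(δ² + Nδ)` with `Nδ = u α²`
      rw [Ideal.span_singleton_le_iff_mem, pow_two, hQ, Ideal.span_pair_mul_span_pair]
      have hδδ : δ * δ ∈ Ideal.span {δ * δ, δ * f α, f α * δ, f α * f α} := Ideal.subset_span (by simp)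
      have hδα : δ * f α ∈ Ideal.span {δ * δ, δ * f α, f α * δ, f α * f α} := Ideal.subset_span (by simp)
      have hαα : f α * f α ∈ Ideal.span {δ * δ, δ * f α, f α * δ, f α * f α} := Ideal.subset_span (by simp)
      have key : δ = f m' * (f α * f α) * δ + f n' * (f m * (δ * f α) * 2 + f n * (δ * δ) + f n * f ((u : 𝓞 K)) * (f α * f α)) := by
        have h1 : f m * f α + f n * f x = 1 := by rw [← map_mul, ← map_mul, ← map_add, hbez, map_one]
        have h2' : f m' * (f α * f α) + f n' * 2 = 1 := by
          rw [← map_mul, ← sq, ← map_mul, ← map_ofNat f 2, ← map_mul, ← map_add, hbez', map_one]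
        have h3 : 2 * (f x) * δ = δ * δ + f ((u : 𝓞 K)) * (f α * f α) := by
          rw [← hxL, ← sq, ← map_mul, ← sq, ← map_mul, ← hN]; exact htr
        linear_combination (-δ) * h2' + (-(f n') * 2 * δ) * h1 + (f n' * f n) * h3
      have hmem : f m' * (f α * f α) * δ + f n' * (f m * (δ * f α) * 2 + f n * (δ * δ) + f n * f ((u : 𝓞 K)) * (f α * f α)) ∈
          Ideal.span {δ * δ, δ * f α, f α * δ, f α * f α} := by
        refine Ideal.add_mem _ (Ideal.mul_mem_right _ _ (Ideal.mul_mem_left _ _ hαα)) (Ideal.mul_mem_left _ _ ?_)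
        refine Ideal.add_mem _ (Ideal.add_mem _ ?_ (Ideal.mul_mem_left _ _ hδδ)) (Ideal.mul_mem_left _ _ hαα)
        exact Ideal.mul_mem_right _ _ (Ideal.mul_mem_left _ _ hδα)
      rwa [← key] at hmem
  refine ⟨hsq, ?_⟩
  -- `N(𝔔)² = N(δ) = (u α²) = (α)²`
  apply Ideal.eq_of_sq_eq_sq
  rw [← map_pow, hsq, Ideal.relNorm_singleton, hN, Ideal.span_singleton_pow, Ideal.span_singleton_eq_span_singleton]
  exact ⟨u⁻¹, by rw [mul_comm ((u : 𝓞 K)), mul_assoc, Units.mul_inv, mul_one]⟩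

end General

end Literature.NumberTheory.NumberFields

end
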